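import Mathlib
import Literature.Computability.AlgebraicComplexity.OrbitClosureProofs
import Summits.ValiantsHypothesis.ValiantsHypothesis.Theorems.RefutationDegreeCertWindowQPLojZero

/-!
# Pulling back a separating test polynomial — stub `stub_pullback` of line `Sketch` (v2)
(crux `CertWindowQP`, stmt-ValiantsHypothesis-5640)

Let `n ≤ m` and suppose the padded permanent `X₀₀^{m-n} per_n` is not in the orbit closure
`Δ[det_m]`. Since `Δ[det_m]` is by definition a Zariski closure in coefficient space
(`mem_orbitClosure_iff`), there is a test polynomial `p` in the coefficients of `m × m` forms which
vanishes on `GL · det_m` but not at the padded permanent. The homogenisation map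
`H(f) = ∑_μ coeff_μ f · X_y^{m-|μ|} X^{ι μ}` of
`Theorems/RefutationDegreeCertWindowQPLojZero.lean` (`y = (0,0)`, `ι` the block placement) is
linear with *constant* coefficients: `coeff_ν H(f) = ∑_μ T_{ν μ} coeff_μ f` (`lojZero_coeff_homog`).
Substituting `X_ν ↦ ∑_μ T_{ν μ} X_μ` into `p` gives a polynomial `q` in variables indexed by the
`x`-monomials `μ` with `q(coeff f) = p(coeff H(f))` for every `x`-polynomial `f` supported in the
chosen finite set of monomials (`pullback_eval_aeval`, `pullback_point_eq_coeffVec`). Hence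

* `q(coeff per_n) = p(coeff X₀₀^{m-n} per_n) ≠ 0` (`lojZero_homog_perPoly`);
* for the generic pencil determinant `PDET = det(A₀ + ∑ x_e A_e)` with indeterminate entries `a`,
  `q(coeff_• PDET)` is a polynomial in `a` whose value at each point `a` is
  `p(coeff H(det A(a)(x))) = 0`, because `H(det A(a)(x)) ∈ End · det_m ⊆ Δ[det_m]`
  (`lojZero_homog_affDet_mem_endOrbit`, `endOrbit_subset_orbitClosure_holds`); so it vanishes
  identically (`MvPolynomial.funext`, `ℂ` infinite) — `pullback_aeval_eq_zero`.
-/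

noncomputable section

open scoped BigOperators
open MvPolynomial

namespace Summit.ValiantsHypothesis.ValiantsHypothesis.Theorems
set_option linter.dupNamespace false

open Literature.Computability.AlgebraicComplexity

section Generic

variable {τ : Type*} {m : ℕ}

/-- Evaluating the pullback `p(X_ν ↦ ∑_μ T_{ν μ} X_μ)` at a point `φ` is evaluating `p` at the
point `ν ↦ ∑_μ T_{ν μ} φ_μ` (composition of evaluation homomorphisms). [folklore] -/
theorem pullback_eval_aeval (y : Fin m × Fin m) (ι : τ → Fin m × Fin m) (S : Finset (τ →₀ ℕ))
    (φ : (τ →₀ ℕ) → ℂ) (p : MvPolynomial ((Fin m × Fin m) →₀ ℕ) ℂ) :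
    MvPolynomial.eval φ (aeval (fun ν : (Fin m × Fin m) →₀ ℕ => ∑ μ ∈ S,
        coeff ν ((X y : MvPolynomial (Fin m × Fin m) ℂ) ^ (m - μ.degree) *
          rename ι (monomial μ (1 : ℂ))) • (X μ : MvPolynomial (τ →₀ ℕ) ℂ)) p) =
      aeval (fun ν : (Fin m × Fin m) →₀ ℕ => ∑ μ ∈ S,
        coeff ν ((X y : MvPolynomial (Fin m × Fin m) ℂ) ^ (m - μ.degree) *
          rename ι (monomial μ (1 : ℂ))) * φ μ) p := by
  rw [← aeval_eq_eval, comp_aeval_apply]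
  simp only [map_sum, map_smul, aeval_X, smul_eq_mul]

/-- At the coefficient point of an `x`-polynomial `f` supported in `S`, the pulled-back evaluation
point `ν ↦ ∑_{μ ∈ S} T_{ν μ} coeff_μ f` is the coefficient vector of the homogenisation `H(f)`
(`lojZero_coeff_homog`, `lojZero_homog_sum_subset`). [folklore] -/
theorem pullback_point_eq_coeffVec (y : Fin m × Fin m) (ι : τ → Fin m × Fin m)
    {S : Finset (τ →₀ ℕ)} {f : MvPolynomial τ ℂ} (hS : f.support ⊆ S) :
    (fun ν : (Fin m × Fin m) →₀ ℕ => ∑ μ ∈ S,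
        coeff ν ((X y : MvPolynomial (Fin m × Fin m) ℂ) ^ (m - μ.degree) *
          rename ι (monomial μ (1 : ℂ))) * coeff μ f) =
      coeffVec (∑ μ ∈ f.support, coeff μ f •
        ((X y : MvPolynomial (Fin m × Fin m) ℂ) ^ (m - μ.degree) *
          rename ι (monomial μ (1 : ℂ)))) := by
  funext ν
  rw [coeffVec_apply, ← lojZero_homog_sum_subset y ι hS, lojZero_coeff_homog]
  exact Finset.sum_congr rfl fun μ _ => mul_comm _ _

/-- **Identical vanishing of the pullback.** Let `p` vanish on `GL · det_m` and let `P_μ` be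
polynomials in unknowns `ρ` such that at every point `a` the values `P_μ(a)` are the coefficients
of an `x`-polynomial `f_a` supported in `S` whose homogenisation lies in `Δ[det_m]`. Then the
pullback `q = p(X_ν ↦ ∑_μ T_{ν μ} X_μ)` satisfies `q(P) = 0` identically: its value at `a` is
`p(coeff H(f_a)) = 0`, and `ℂ` is infinite (`MvPolynomial.funext`). [folklore] -/
theorem pullback_aeval_eq_zero {ρ : Type*} (y : Fin m × Fin m) (ι : τ → Fin m × Fin m)
    (S : Finset (τ →₀ ℕ)) {p : MvPolynomial ((Fin m × Fin m) →₀ ℕ) ℂ}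
    (hp : ∀ h ∈ glOrbit (Fin m × Fin m) ℂ (detPoly (Fin m) ℂ), aeval (coeffVec h) p = 0)
    (P : (τ →₀ ℕ) → MvPolynomial ρ ℂ)
    (hP : ∀ a : ρ → ℂ, ∃ f : MvPolynomial τ ℂ, f.support ⊆ S ∧
      (∀ μ, MvPolynomial.eval a (P μ) = coeff μ f) ∧
      (∑ μ ∈ f.support, coeff μ f •
        ((X y : MvPolynomial (Fin m × Fin m) ℂ) ^ (m - μ.degree) *
          rename ι (monomial μ (1 : ℂ)))) ∈ orbitClosure (detPoly (Fin m) ℂ)) :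
    aeval P (aeval (fun ν : (Fin m × Fin m) →₀ ℕ => ∑ μ ∈ S,
        coeff ν ((X y : MvPolynomial (Fin m × Fin m) ℂ) ^ (m - μ.degree) *
          rename ι (monomial μ (1 : ℂ))) • (X μ : MvPolynomial (τ →₀ ℕ) ℂ)) p) = 0 := by
  refine MvPolynomial.funext fun a => ?_
  obtain ⟨f, hS, hPf, hmem⟩ := hP a
  have hpt : (fun μ => aeval a (P μ)) = fun μ => coeff μ f := funext hPf
  rw [map_zero, ← aeval_eq_eval, comp_aeval_apply, hpt, aeval_eq_eval, pullback_eval_aeval,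
    pullback_point_eq_coeffVec y ι hS]
  exact (mem_orbitClosure_iff.mp hmem) p hp

end Generic

/-- **Pullback of a separating test polynomial** (content of stub `stub_pullback`, line `Sketch`
v2 of crux `CertWindowQP`). If `n ≤ m` and `X₀₀^{m-n} per_n ∉ Δ[det_m]`, there is a polynomial `q`
in variables indexed by the `x`-monomials `(Fin n × Fin n) →₀ ℕ` with `q(coeff per_n) ≠ 0` and
`q(coeff_• det(A₀ + ∑ x_e A_e)) = 0` identically in the indeterminate entries of `A₀, A_e`.
Proof: module docstring. [folklore] -/
theorem certWindowQP_pullback (n m : ℕ) [NeZero m] (hnm : n ≤ m)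
    (hpad : paddedPerPoly ℂ n m ∉ orbitClosure (detPoly (Fin m) ℂ)) :
    ∃ q : MvPolynomial ((Fin n × Fin n) →₀ ℕ) ℂ,
      MvPolynomial.eval (fun μ : (Fin n × Fin n) →₀ ℕ => MvPolynomial.coeff μ (perPoly (Fin n) ℂ)) q ≠ 0 ∧
      MvPolynomial.aeval (fun μ : (Fin n × Fin n) →₀ ℕ => MvPolynomial.coeff μ (Matrix.of fun i j : Fin m => MvPolynomial.C (MvPolynomial.X (none, (i, j))) + ∑ e : Fin n × Fin n, MvPolynomial.X e * MvPolynomial.C (MvPolynomial.X (some e, (i, j))) : Matrix (Fin m) (Fin m) (MvPolynomial (Fin n × Fin n) (MvPolynomial (Option (Fin n × Fin n) × (Fin m × Fin m)) ℂ))).det) q = 0 := by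
  classical
  rw [mem_orbitClosure_iff] at hpad
  push Not at hpad
  obtain ⟨p, hp, hp0⟩ := hpad
  obtain ⟨e⟩ : Nonempty (Fin n ≃ BlockIdx n m) :=
    ⟨(Fintype.equivFinOfCardEq (card_blockIdx hnm)).symm⟩
  refine ⟨aeval (fun ν : (Fin m × Fin m) →₀ ℕ => ∑ μ ∈ (Matrix.of fun i j : Fin m =>
      MvPolynomial.C (MvPolynomial.X (none, (i, j))) +
        ∑ e : Fin n × Fin n, MvPolynomial.X e * MvPolynomial.C (MvPolynomial.X (some e, (i, j))) :
      Matrix (Fin m) (Fin m) (MvPolynomial (Fin n × Fin n)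
        (MvPolynomial (Option (Fin n × Fin n) × (Fin m × Fin m)) ℂ))).det.support ∪
          (perPoly (Fin n) ℂ).support,
      coeff ν ((X ((0 : Fin m), (0 : Fin m)) : MvPolynomial (Fin m × Fin m) ℂ) ^ (m - μ.degree) *
        rename ((fun ij : BlockIdx n m × BlockIdx n m => ((ij.1 : Fin m), (ij.2 : Fin m))) ∘
          Prod.map e e) (monomial μ (1 : ℂ))) •
        (X μ : MvPolynomial ((Fin n × Fin n) →₀ ℕ) ℂ)) p, ?_, ?_⟩
  · -- `q(coeff per_n) = p(coeff X₀₀^{m-n} per_n) ≠ 0`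
    rw [pullback_eval_aeval, pullback_point_eq_coeffVec _ _ Finset.subset_union_right,
      lojZero_homog_perPoly e]
    exact hp0
  · -- `q(coeff_• PDET)` vanishes at every point `a`, hence identically
    refine pullback_aeval_eq_zero _ _ _ hp _ fun a => ?_
    exact ⟨_, (lojZero_support_affDet_subset n m a).trans Finset.subset_union_left,
      fun μ => by rw [← coeff_map, lojZero_map_eval_pencilDet],
      endOrbit_subset_orbitClosure_holds _
        (lojZero_homog_affDet_mem_endOrbit _ _ (fun ij => a (none, ij)) (fun t ij => a (some t, ij)))⟩

/-- **Registered stub `stub_pullback`** of line `Sketch` (v2, algebraic transfer; crux `CertWindowQP`,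
stmt-ValiantsHypothesis-5640), verbatim signature of the registered skeleton; proved by
`certWindowQP_pullback`. -/
theorem stub_pullback (n m : ℕ) [NeZero m] (hnm : n ≤ m)
    (hpad : paddedPerPoly ℂ n m ∉ orbitClosure (detPoly (Fin m) ℂ)) :
    ∃ q : MvPolynomial ((Fin n × Fin n) →₀ ℕ) ℂ,
      MvPolynomial.eval (fun μ : (Fin n × Fin n) →₀ ℕ => MvPolynomial.coeff μ (perPoly (Fin n) ℂ)) q ≠ 0 ∧
      MvPolynomial.aeval (fun μ : (Fin n × Fin n) →₀ ℕ => MvPolynomial.coeff μ (Matrix.of fun i j : Fin m => MvPolynomial.C (MvPolynomial.X (none, (i, j))) + ∑ e : Fin n × Fin n, MvPolynomial.X e * MvPolynomial.C (MvPolynomial.X (some e, (i, j))) : Matrix (Fin m) (Fin m) (MvPolynomial (Fin n × Fin n) (MvPolynomial (Option (Fin n × Fin n) × (Fin m × Fin m)) ℂ))).det) q = 0 :=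
  certWindowQP_pullback n m hnm hpad

end Summit.ValiantsHypothesis.ValiantsHypothesis.Theorems

end
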